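import Summits.HubbardSuperconductivity.HubbardSuperconductivity.Theorems.WidthHaldaneTubeLandauForm

/-!
# The Landau identity, the floor transfer and the reverse Bloch bound on the Hubbard tube

Support file for crux `WidthUniformThermodynamics` (stmt-HubbardSuperconductivity-16312; routes
`WidthHaldane`, `SeamInduction`), continuing `WidthHaldaneTubeLandauForm.lean`: there the gauge
Rayleigh bound was put in LANDAU FORM, `E(θ, N) ≤ Re⟨ψ,H₀ψ⟩ + (1 - cos(θ/L))K(ψ) + sin(θ/L)J(ψ)`
for every unit vector of the sector `(N, S^z = 0)`, with the longitudinal kinetic form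
`K(ψ) = Σ_{a,b,σ} Re⟨ψ,(c†_{(a,b)σ}c_{(a-1,b)σ} + h.c.)ψ⟩` and the total longitudinal current
`J(ψ) = Σ_{a,b,σ} Im⟨ψ,(c†_{(a,b)σ}c_{(a-1,b)σ} - h.c.)ψ⟩` of the UNTWISTED tube (written out). Here,
PROVED without definitions and without named facts (first lemmas of the crux idea
`Cruxes/WidthUniformThermodynamics/Ideas/landau-window-yrast.md` and of the typing note in
`Cruxes/WidthUniformThermodynamics/FLOOR-INVENTORY-k2r1.md`):

* `abs_siteKinetic_le`, `abs_siteCurrent_le`, `abs_longKinetic_le`, `abs_longCurrent_le` —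
  `|K(ψ)|, |J(ψ)| ≤ 2LM` for a unit vector (hopping amplitudes `≤ 1/2`);
* **`tubeEnergy_eq_sInf_landau`** — the LANDAU IDENTITY: `E(θ, N)` IS the infimum of the Landau form
  over the unit vectors of the sector (one Hamiltonian `tubeH0`, two one-body observables, no flux
  operator left: F. Bloch's flux/yrast duality as finite-dimensional linear algebra);
* **`le_tubeEnergy_of_forall_landau_ge`** — the FLOOR TRANSFER (the inventory's `LandauFloor ⇒ (i)`):
  a floor on the Landau form valid for every unit sector vector is a floor on `E(θ, N)`;
* `tubeEnergy_zero_le_re_expect` — `E(0, N) ≤ Re⟨ψ, H₀ψ⟩` (excitation energies are non-negative);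
* **`sin_mul_abs_longCurrent_le`** / `currentEnergyBound` (closed form, the registered sub-goal) —
  the REVERSE BLOCH BOUND (`CurrentEnergyBound` of the card): for every unit sector vector,
  `sin(π/L)·|J(ψ)| ≤ Re⟨ψ, H₀ψ⟩ - E(0, N) + 2π²M/L` (`L ≥ 3`) — a state carrying total longitudinal
  current `|J| ≫ M` lies `≳ |J|/L` above the sector floor, so any Landau-type criterion only concerns
  the window `{Re⟨H₀⟩ - E(0) ≲ M/L, |J| ≲ M}` (inputs: the Landau-form bound at flux `±π`, the
  landed window `|E(π) - E(0)| ≤ π²M/L` of `WidthHaldaneTubeSemiconcave`, and `|K| ≤ 2LM`).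

Companion: `WidthHaldaneTubeLandauCriterion.lean` (stiffness from a Landau criterion). Handles for a
line of the crux typed in Landau form, not progress on its open core. References: F. Bloch, Phys.
Rev. A 7 (1973) 2187; D. Bohm, Phys. Rev. 75 (1949) 502; H. Watanabe, J. Stat. Phys. 177 (2019)
717, §2.2–§4.1.
-/

noncomputable section

namespace Summit.HubbardSuperconductivity.HubbardSuperconductivity.Theorems.WidthHaldane

set_option linter.dupNamespace false -- summit = problem name (single-conjunct summit), D-0017

open scoped BigOperators Classical Matrix ComplexConjugate
open Matrix Literature.MathematicalPhysics.QuantumLattice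

section LandauWindow

variable (L M : ℕ) [NeZero L] [NeZero M] (Λ : Type) [LinearOrder Λ] [Fintype Λ]
  (e : Λ ≃ ZMod L × ZMod M)

/-! ### A-priori bounds, site-indexed -/

omit [NeZero L] [NeZero M] [LinearOrder Λ] [Fintype Λ] in
/-- `x + e₁ ≠ x` on the tube (`L ≥ 2`). [folklore] -/
theorem step_ne_self (hL : 2 ≤ L) (x : Λ) : e.symm ((e x).1 + 1, (e x).2) ≠ x := by
  haveI : Fact (1 < L) := ⟨by omega⟩
  intro hx
  have h := congrArg (fun z : Λ => (e z).1) hx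
  simp only [Equiv.apply_symm_apply] at h
  exact one_ne_zero (by linear_combination h : (1 : ZMod L) = 0)

/-- `|Σ_{x,σ} 2Re⟨ψ, c†_{x+e₁,σ}c_{xσ}ψ⟩| ≤ 2LM` for a unit vector: each of the `2LM` amplitudes has
modulus `≤ 1/2` (`L ≥ 2`). [folklore] -/
theorem abs_siteKinetic_le (hL : 2 ≤ L) {ψ : Fock (Orb Λ)} (h1 : star ψ ⬝ᵥ ψ = 1) :
    |∑ x : Λ, ∑ σ : Fin 2,
        2 * (expect (creation (orb (e.symm ((e x).1 + 1, (e x).2)) σ) * annihilation (orb x σ)) ψ).re| ≤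
      2 * ((L : ℝ) * M) := by
  calc |∑ x : Λ, ∑ σ : Fin 2,
          2 * (expect (creation (orb (e.symm ((e x).1 + 1, (e x).2)) σ) * annihilation (orb x σ)) ψ).re|
      ≤ ∑ x : Λ, |∑ σ : Fin 2,
          2 * (expect (creation (orb (e.symm ((e x).1 + 1, (e x).2)) σ) * annihilation (orb x σ)) ψ).re| :=
        Finset.abs_sum_le_sum_abs _ _
    _ ≤ ∑ x : Λ, ∑ σ : Fin 2,
          |2 * (expect (creation (orb (e.symm ((e x).1 + 1, (e x).2)) σ) * annihilation (orb x σ)) ψ).re| :=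
        Finset.sum_le_sum fun x _ => Finset.abs_sum_le_sum_abs _ _
    _ ≤ ∑ _x : Λ, ∑ _σ : Fin 2, (1 : ℝ) := by
        refine Finset.sum_le_sum fun x _ => Finset.sum_le_sum fun σ _ => ?_
        have h := abs_re_star_dotProduct_creation_mul_annihilation_mulVec_le_half h1
          (p := orb (e.symm ((e x).1 + 1, (e x).2)) σ) (q := orb x σ)
          (fun h => step_ne_self L M Λ e hL x (congrArg (fun o : Orb Λ => (ofLex o).1) h))
        rw [abs_mul, abs_two]
        change |(expect _ ψ).re| ≤ 1 / 2 at h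
        linarith
    _ = 2 * ((L : ℝ) * M) := by
        simp only [Finset.sum_const, Finset.card_univ, Fintype.card_fin, card_carrier L M Λ e]
        ring

/-- `|Σ_{x,σ} 2Im⟨ψ, c†_{x+e₁,σ}c_{xσ}ψ⟩| ≤ 2LM` for a unit vector: each of the `2LM` amplitudes has
modulus `≤ 1/2` (`L ≥ 2`). [folklore] -/
theorem abs_siteCurrent_le (hL : 2 ≤ L) {ψ : Fock (Orb Λ)} (h1 : star ψ ⬝ᵥ ψ = 1) :
    |∑ x : Λ, ∑ σ : Fin 2,
        2 * (expect (creation (orb (e.symm ((e x).1 + 1, (e x).2)) σ) * annihilation (orb x σ)) ψ).im| ≤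
      2 * ((L : ℝ) * M) := by
  calc |∑ x : Λ, ∑ σ : Fin 2,
          2 * (expect (creation (orb (e.symm ((e x).1 + 1, (e x).2)) σ) * annihilation (orb x σ)) ψ).im|
      ≤ ∑ x : Λ, |∑ σ : Fin 2,
          2 * (expect (creation (orb (e.symm ((e x).1 + 1, (e x).2)) σ) * annihilation (orb x σ)) ψ).im| :=
        Finset.abs_sum_le_sum_abs _ _
    _ ≤ ∑ x : Λ, ∑ σ : Fin 2,
          |2 * (expect (creation (orb (e.symm ((e x).1 + 1, (e x).2)) σ) * annihilation (orb x σ)) ψ).im| :=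
        Finset.sum_le_sum fun x _ => Finset.abs_sum_le_sum_abs _ _
    _ ≤ ∑ _x : Λ, ∑ _σ : Fin 2, (1 : ℝ) := by
        refine Finset.sum_le_sum fun x _ => Finset.sum_le_sum fun σ _ => ?_
        have h := norm_star_dotProduct_creation_mul_annihilation_mulVec_le_half h1
          (p := orb (e.symm ((e x).1 + 1, (e x).2)) σ) (q := orb x σ)
          (fun h => step_ne_self L M Λ e hL x (congrArg (fun o : Orb Λ => (ofLex o).1) h))
        rw [abs_mul, abs_two]
        change ‖expect _ ψ‖ ≤ 1 / 2 at h
        have him := Complex.abs_im_le_norm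
          (expect (creation (orb (e.symm ((e x).1 + 1, (e x).2)) σ) * annihilation (orb x σ)) ψ)
        linarith
    _ = 2 * ((L : ℝ) * M) := by
        simp only [Finset.sum_const, Finset.card_univ, Fintype.card_fin, card_carrier L M Λ e]
        ring

/-! ### A-priori bounds on `K` and `J` -/

/-- **`|K(ψ)| ≤ 2LM`** for a unit vector (`L ≥ 2`). [folklore] -/
theorem abs_longKinetic_le (hL : 2 ≤ L) {ψ : Fock (Orb Λ)} (h1 : star ψ ⬝ᵥ ψ = 1) :
    |∑ a : ZMod L, ∑ b : ZMod M, ∑ σ : Fin 2,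
        (expect (creation (orb (e.symm (a, b)) σ) * annihilation (orb (e.symm (a - 1, b)) σ) +
          creation (orb (e.symm (a - 1, b)) σ) * annihilation (orb (e.symm (a, b)) σ)) ψ).re| ≤
      2 * ((L : ℝ) * M) := by
  rw [← (siteForms_eq_columnForms L M Λ e ψ).1]
  exact abs_siteKinetic_le L M Λ e hL h1

/-- **`|J(ψ)| ≤ 2LM`** for a unit vector (`L ≥ 2`). [folklore] -/
theorem abs_longCurrent_le (hL : 2 ≤ L) {ψ : Fock (Orb Λ)} (h1 : star ψ ⬝ᵥ ψ = 1) :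
    |∑ a : ZMod L, ∑ b : ZMod M, ∑ σ : Fin 2,
        (expect (creation (orb (e.symm (a, b)) σ) * annihilation (orb (e.symm (a - 1, b)) σ) -
          creation (orb (e.symm (a - 1, b)) σ) * annihilation (orb (e.symm (a, b)) σ)) ψ).im| ≤
      2 * ((L : ℝ) * M) := by
  rw [← (siteForms_eq_columnForms L M Λ e ψ).2]
  exact abs_siteCurrent_le L M Λ e hL h1

/-! ### The Landau identity and the floor transfer -/

/-- **The Landau identity** (`L ≥ 3`): the twisted sector energy is a variational problem for the
UNTWISTED tube, `E_{L,M}(U; θ, N) = inf {Re⟨ψ,H₀ψ⟩ + (1 - cos(θ/L))K(ψ) + sin(θ/L)J(ψ) : ψ ∈ (N, S^z=0), ‖ψ‖ = 1}`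
(the flux enters only through `cos(θ/L)`, `sin(θ/L)`; F. Bloch's yrast/flux duality, Phys. Rev. A 7
(1973) 2187, in finite dimensions). [cite: Watanabe2019, §2.2.3 and §4.1] -/
theorem tubeEnergy_eq_sInf_landau (hL : 3 ≤ L) (U θ : ℝ) (N : ℕ) :
    tubeEnergy L M Λ e U θ N = sInf {F : ℝ | ∃ ψ ∈ szSector (Λ := Λ) N 0, star ψ ⬝ᵥ ψ = 1 ∧
      F = (expect (tubeH0 L M Λ e U) ψ).re +
        (1 - Real.cos (θ / L)) * (∑ a : ZMod L, ∑ b : ZMod M, ∑ σ : Fin 2,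
          (expect (creation (orb (e.symm (a, b)) σ) * annihilation (orb (e.symm (a - 1, b)) σ) +
            creation (orb (e.symm (a - 1, b)) σ) * annihilation (orb (e.symm (a, b)) σ)) ψ).re) +
        Real.sin (θ / L) * (∑ a : ZMod L, ∑ b : ZMod M, ∑ σ : Fin 2,
          (expect (creation (orb (e.symm (a, b)) σ) * annihilation (orb (e.symm (a - 1, b)) σ) -
            creation (orb (e.symm (a - 1, b)) σ) * annihilation (orb (e.symm (a, b)) σ)) ψ).im)} := by
  rw [tubeEnergy_eq_sInf_price L M Λ e hL U θ N]
  congr 1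
  ext F
  simp only [Set.mem_setOf_eq]
  refine exists_congr fun ψ => and_congr_right fun _ => and_congr_right fun _ => ?_
  rw [price_eq_landau L M Λ e hL θ ψ, add_assoc]

/-- **Floor transfer in Landau form** (`L ≥ 3`; the inventory's `LandauFloor ⇒ (i)` step): if the
sector `(N, S^z = 0)` has a unit vector and `c ≤ Re⟨ψ,H₀ψ⟩ + (1 - cos(θ/L))K(ψ) + sin(θ/L)J(ψ)` for
EVERY unit vector `ψ` of the sector, then `c ≤ E_{L,M}(U; θ, N)`. [folklore] -/
theorem le_tubeEnergy_of_forall_landau_ge (hL : 3 ≤ L) (U θ : ℝ) (N : ℕ) {c : ℝ}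
    (hne : ∃ ψ ∈ szSector (Λ := Λ) N 0, star ψ ⬝ᵥ ψ = 1)
    (h : ∀ ψ ∈ szSector (Λ := Λ) N 0, star ψ ⬝ᵥ ψ = 1 →
      c ≤ (expect (tubeH0 L M Λ e U) ψ).re +
        (1 - Real.cos (θ / L)) * (∑ a : ZMod L, ∑ b : ZMod M, ∑ σ : Fin 2,
          (expect (creation (orb (e.symm (a, b)) σ) * annihilation (orb (e.symm (a - 1, b)) σ) +
            creation (orb (e.symm (a - 1, b)) σ) * annihilation (orb (e.symm (a, b)) σ)) ψ).re) +
        Real.sin (θ / L) * (∑ a : ZMod L, ∑ b : ZMod M, ∑ σ : Fin 2,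
          (expect (creation (orb (e.symm (a, b)) σ) * annihilation (orb (e.symm (a - 1, b)) σ) -
            creation (orb (e.symm (a - 1, b)) σ) * annihilation (orb (e.symm (a, b)) σ)) ψ).im)) :
    c ≤ tubeEnergy L M Λ e U θ N :=
  le_tubeEnergy_of_forall_price_ge L M Λ e hL U θ N hne fun ψ hψ h1 => by
    rw [price_eq_landau L M Λ e hL θ ψ, ← add_assoc]
    exact h ψ hψ h1

/-! ### The excitation window -/

/-- The untwisted sector energy is below every Rayleigh quotient of the sector:
`E_{L,M}(U; 0, N) ≤ Re⟨ψ, H₀ψ⟩` (the excitation energy `Re⟨ψ,H₀ψ⟩ - E(0,N)` of the Landau form is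
non-negative). [folklore] -/
theorem tubeEnergy_zero_le_re_expect (U : ℝ) (N : ℕ) {ψ : Fock (Orb Λ)} (hψ : ψ ∈ szSector N 0)
    (h1 : star ψ ⬝ᵥ ψ = 1) : tubeEnergy L M Λ e U 0 N ≤ (expect (tubeH0 L M Λ e U) ψ).re := by
  rw [tubeEnergy_zero]
  have hH : (tubeH0 L M Λ e U).IsHermitian := by
    simpa using isHermitian_tubeH L M Λ e U 0
  exact minEnergyOn_le_rayleigh_of_mem hH _ hψ h1

/-! ### The reverse Bloch bound: current costs energy -/

/-- **The reverse Bloch bound** (`L ≥ 3`; card `landau-window-yrast`, `CurrentEnergyBound`): for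
every unit vector `ψ` of the sector `(N, S^z = 0)`,
`sin(π/L)·|J(ψ)| ≤ Re⟨ψ, H₀ψ⟩ - E_{L,M}(U; 0, N) + 2π²M/L`.
Proof: the gauge Rayleigh bound at flux `±π` reads `E(π) ≤ Re⟨ψ,H₀ψ⟩ + (1 - cos(π/L))K ± sin(π/L)J`
(`E(-π) = E(π)`), while `E(π) ≥ E(0) - π²M/L` (`abs_tubeEnergy_pi_sub_zero_le`) and
`(1 - cos(π/L))K ≤ (π²/2L²)·2LM`. So a state carrying total current `|J|` lies at least
`sin(π/L)|J| - 2π²M/L ≈ π|J|/L - 2π²M/L` above the sector floor. [folklore] -/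
theorem sin_mul_abs_longCurrent_le (hL : 3 ≤ L) (U : ℝ) (N : ℕ) {ψ : Fock (Orb Λ)}
    (hψ : ψ ∈ szSector N 0) (h1 : star ψ ⬝ᵥ ψ = 1) :
    Real.sin (Real.pi / L) * |∑ a : ZMod L, ∑ b : ZMod M, ∑ σ : Fin 2,
        (expect (creation (orb (e.symm (a, b)) σ) * annihilation (orb (e.symm (a - 1, b)) σ) -
          creation (orb (e.symm (a - 1, b)) σ) * annihilation (orb (e.symm (a, b)) σ)) ψ).im| ≤
      (expect (tubeH0 L M Λ e U) ψ).re - tubeEnergy L M Λ e U 0 N + 2 * Real.pi ^ 2 * M / L := by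
  have hL0 : (0 : ℝ) < L := by exact_mod_cast Nat.pos_of_ne_zero (NeZero.ne L)
  have hL1 : (1 : ℝ) ≤ L := by exact_mod_cast Nat.pos_of_ne_zero (NeZero.ne L)
  have hM0 : (0 : ℝ) ≤ M := by positivity
  set K := ∑ a : ZMod L, ∑ b : ZMod M, ∑ σ : Fin 2,
    (expect (creation (orb (e.symm (a, b)) σ) * annihilation (orb (e.symm (a - 1, b)) σ) +
      creation (orb (e.symm (a - 1, b)) σ) * annihilation (orb (e.symm (a, b)) σ)) ψ).re with hK
  set J := ∑ a : ZMod L, ∑ b : ZMod M, ∑ σ : Fin 2,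
    (expect (creation (orb (e.symm (a, b)) σ) * annihilation (orb (e.symm (a - 1, b)) σ) -
      creation (orb (e.symm (a - 1, b)) σ) * annihilation (orb (e.symm (a, b)) σ)) ψ).im with hJ
  have hp := tubeEnergy_le_landau L M Λ e hL U Real.pi N hψ h1
  have hm := tubeEnergy_le_landau L M Λ e hL U (-Real.pi) N hψ h1
  rw [tubeEnergy_neg, neg_div, Real.cos_neg, Real.sin_neg] at hm
  rw [← hK, ← hJ] at hp hm
  have hπ := abs_tubeEnergy_pi_sub_zero_le L M Λ e hL U N
  rw [abs_le] at hπ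
  have hKabs := abs_longKinetic_le L M Λ e (by omega) h1
  rw [← hK] at hKabs
  have hcos : 1 - Real.cos (Real.pi / L) ≤ (Real.pi / L) ^ 2 / 2 := by
    have := two_sub_two_mul_cos_le_sq (Real.pi / L)
    linarith
  have hcos0 : 0 ≤ 1 - Real.cos (Real.pi / L) := by linarith [Real.cos_le_one (Real.pi / L)]
  have hKb : (1 - Real.cos (Real.pi / L)) * K ≤ Real.pi ^ 2 * M / L := by
    calc (1 - Real.cos (Real.pi / L)) * K ≤ (1 - Real.cos (Real.pi / L)) * |K| :=
          mul_le_mul_of_nonneg_left (le_abs_self K) hcos0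
      _ ≤ (Real.pi / L) ^ 2 / 2 * (2 * ((L : ℝ) * M)) := mul_le_mul hcos hKabs (abs_nonneg K) (by positivity)
      _ = Real.pi ^ 2 * M / L := by
          field_simp
  have hsin0 : 0 ≤ Real.sin (Real.pi / L) :=
    Real.sin_nonneg_of_nonneg_of_le_pi (by positivity) (div_le_self Real.pi_pos.le hL1)
  have hY : 2 * Real.pi ^ 2 * (M : ℝ) / L = 2 * (Real.pi ^ 2 * M / L) := by ring
  rw [hY, ← abs_of_nonneg hsin0, ← abs_mul, abs_le]
  constructor <;> linarith [hπ.1, hπ.2]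

end LandauWindow

/-- **THE REVERSE BLOCH BOUND, closed form** (the registered sub-goal `currentEnergyBound` of crux
stmt-HubbardSuperconductivity-16312; all binders universally quantified): for `L ≥ 3`, every
`U, N`, every labelling and every unit vector `ψ` of the sector `(N, S^z = 0)`,
`sin(π/L)·|J(ψ)| ≤ Re⟨ψ, H₀ψ⟩ - E_{L,M}(U; 0, N) + 2π²M/L`. [folklore] -/
theorem currentEnergyBound : ∀ (L M : ℕ) [NeZero L] [NeZero M] (Λ : Type) [LinearOrder Λ] [Fintype Λ] (e : Λ ≃ ZMod L × ZMod M), 3 ≤ L → ∀ (U : ℝ) (N : ℕ) (ψ : Fock (Orb Λ)), ψ ∈ szSector N 0 → star ψ ⬝ᵥ ψ = 1 → Real.sin (Real.pi / L) * |∑ a : ZMod L, ∑ b : ZMod M, ∑ σ : Fin 2, (expect (creation (orb (e.symm (a, b)) σ) * annihilation (orb (e.symm (a - 1, b)) σ) - creation (orb (e.symm (a - 1, b)) σ) * annihilation (orb (e.symm (a, b)) σ)) ψ).im| ≤ (expect (tubeH0 L M Λ e U) ψ).re - tubeEnergy L M Λ e U 0 N + 2 * Real.pi ^ 2 * M / L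 :=
  fun L M _ _ Λ _ _ e hL U N _ψ hψ h1 => sin_mul_abs_longCurrent_le L M Λ e hL U N hψ h1

end Summit.HubbardSuperconductivity.HubbardSuperconductivity.Theorems.WidthHaldane

end
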